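import Mathlib
import Summits.Parity.BatemanHorn.Theorems.IsogenyRedeiSplitBlockJacobiShell
import Summits.Parity.BatemanHorn.Theorems.IsogenyRedeiSplitBlockJacobiCells
import Summits.Parity.BatemanHorn.Theorems.IsogenyRedeiSplitBlockJacobiPoissonMasterBound
import Summits.Parity.BatemanHorn.Theorems.IsogenyRedeiSplitBlockJacobiPoissonAsymptotics
import Summits.Parity.BatemanHorn.Theorems.IsogenyRedeiSplitBlockJacobiWeylDefs
import HarnessLib

/-!
# `stub_poissonReduction` (line `cofactor-root-discrepancy`, crux `SplitBlockJacobi`,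
stmt-Parity-11583): the tier Weyl bound controls the bulk root discrepancy

`TierWeylBound θ μ → ∀ ε > 0, eventually |D^{bulk}_{θ,μ}(x)| ≤ ε x`.

Proof (finite Fourier analysis on `ℤ/qℤ`, all in the tree's `…Poisson` helper files): smoothing of
the `t`-cutoff by a discrete `k`-fold box convolution (loss `≤ 219 k L`, `L = ⌊η′x⌋`), the exact
Fourier expansion of the weighted root count modulo `q = QQ′` (`ρ(QQ′) = 4`), sorting of the bulk
pairs into the cells of the grid `⌊x^θ (1 + 1/T)^i⌋` (`T = ⌊x^{ε₀/8}⌋`), two-dimensional Abel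
summation plus the hypothesis on each good cell for the frequencies `0 < |h| ≤ 4 g_i g_j x^{ε₀/8-1}`,
the decay of the cutoff's transform beyond, and a direct mass estimate on the hyperbolic shell
(`abs_Dbulk_le_master`); finally `eventually_master_rhs_le`.  The vocabulary (`Dbulk`,
`TierWeylBound`, …) is the line's, imported from `…WeylDefs` (verbatim from the skeleton).
-/

noncomputable section

open Finset Filter

namespace Summit.Parity.BatemanHorn.Cruxes.SplitBlockJacobi.CofactorRootDiscrepancy

/-! ### The stub -/

/-- `x ≤ ⌊x^θ⌋²` once `x^{θ − 1/2} ≥ 2` (`x ≥ 1`). -/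
theorem le_floor_rpow_mul_self {θ : ℝ} {x : ℕ} (hx : 1 ≤ x)
    (h2 : (2 : ℝ) ≤ (x : ℝ) ^ (θ - 1 / 2)) : x ≤ ⌊(x : ℝ) ^ θ⌋₊ * ⌊(x : ℝ) ^ θ⌋₊ := by
  have hxR : (0 : ℝ) < x := by exact_mod_cast (show 0 < x by omega)
  have hxR1 : (1 : ℝ) ≤ x := by exact_mod_cast hx
  have hhalf : 1 ≤ (x : ℝ) ^ (1 / 2 : ℝ) := Real.one_le_rpow hxR1 (by norm_num)
  have hsplit : (x : ℝ) ^ θ = (x : ℝ) ^ (1 / 2 : ℝ) * (x : ℝ) ^ (θ - 1 / 2) := by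
    rw [← Real.rpow_add hxR]; ring_nf
  have hfl : (x : ℝ) ^ (1 / 2 : ℝ) ≤ ⌊(x : ℝ) ^ θ⌋₊ := by
    have := Nat.lt_floor_add_one ((x : ℝ) ^ θ)
    nlinarith
  have hsq : (x : ℝ) = (x : ℝ) ^ (1 / 2 : ℝ) * (x : ℝ) ^ (1 / 2 : ℝ) := by
    rw [← Real.rpow_add hxR]; norm_num
  have : (x : ℝ) ≤ (⌊(x : ℝ) ^ θ⌋₊ : ℝ) * ⌊(x : ℝ) ^ θ⌋₊ :=
    calc (x : ℝ) = (x : ℝ) ^ (1 / 2 : ℝ) * (x : ℝ) ^ (1 / 2 : ℝ) := hsq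
      _ ≤ (⌊(x : ℝ) ^ θ⌋₊ : ℝ) * ⌊(x : ℝ) ^ θ⌋₊ := mul_le_mul hfl hfl (by positivity) (by positivity)
  exact_mod_cast this

/-- The grid with `I = T (log₂⌊x²+2⌋ + 1)` steps reaches height `x² + 2`. -/
theorem reach_of_grid {θ : ℝ} {x T : ℕ} (hx : 1 ≤ x) (hθ : 0 ≤ θ) (hT : 1 ≤ T) :
    x ^ 2 + 2 ≤ ⌊(x : ℝ) ^ θ * (1 + 1 / (T : ℝ)) ^ (T * (Nat.log 2 (x ^ 2 + 2) + 1))⌋₊ := by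
  refine Nat.le_floor ?_
  have hxR1 : (1 : ℝ) ≤ x := by exact_mod_cast hx
  have h1 : (1 : ℝ) ≤ (x : ℝ) ^ θ := Real.one_le_rpow hxR1 hθ
  have h2 := Poisson.two_pow_le_pow_mul T (Nat.log 2 (x ^ 2 + 2) + 1) hT
  have h3 : x ^ 2 + 2 < 2 ^ (Nat.log 2 (x ^ 2 + 2) + 1) := Nat.lt_pow_succ_log_self (by norm_num) _
  have h3R : ((x ^ 2 + 2 : ℕ) : ℝ) ≤ (2 : ℝ) ^ (Nat.log 2 (x ^ 2 + 2) + 1) := by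
    exact_mod_cast h3.le
  calc ((x ^ 2 + 2 : ℕ) : ℝ) ≤ 1 * (2 : ℝ) ^ (Nat.log 2 (x ^ 2 + 2) + 1) := by rw [one_mul]; exact h3R
    _ ≤ (x : ℝ) ^ θ * (1 + 1 / (T : ℝ)) ^ (T * (Nat.log 2 (x ^ 2 + 2) + 1)) :=
        mul_le_mul h1 h2 (by positivity) (by positivity)

/-- **stub_poissonReduction** — PROVED: the tier Weyl bound controls the bulk discrepancy. -/
theorem stub_poissonReduction :
    ∀ θ μ : ℝ, 1 / 2 < θ → θ < 1 → 0 < μ → μ < 1 → TierWeylBound θ μ →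
      ∀ ε : ℝ, 0 < ε → ∀ᶠ x : ℕ in atTop, |Dbulk θ μ x| ≤ ε * x := by
  intro θ μ hθ hθ1 hμ0 hμ1 hTWB ε hε
  obtain ⟨ε₀', hε₀', x₀, hT⟩ := hTWB
  -- parameters
  set ε₀ : ℝ := min ε₀' 1 with hε₀def
  have hε₀ : 0 < ε₀ := lt_min hε₀' one_pos
  have hε₀1 : ε₀ ≤ 1 := min_le_right _ _
  have hε₀le : ε₀ ≤ ε₀' := min_le_left _ _
  set ε' : ℝ := min ε 1 with hε'def
  have hε' : 0 < ε' := lt_min hε one_pos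
  have hε'1 : ε' ≤ 1 := min_le_right _ _
  have hε'ε : ε' ≤ ε := min_le_left _ _
  set k : ℕ := ⌈32 / ε₀⌉₊ with hkdef
  have hk : 4 ≤ ε₀ / 8 * (k + 1) := by
    have h1 : 32 / ε₀ ≤ k := Nat.le_ceil _
    rw [div_le_iff₀ hε₀] at h1
    nlinarith
  set η' : ℝ := ε' / (1000 * ((k : ℝ) + 1)) with hη'def
  have hη' : 0 < η' := by positivity
  have hkη : 219 * k * η' ≤ ε' / 4 := by
    rw [hη'def]
    have hk0 : (0 : ℝ) ≤ k := Nat.cast_nonneg _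
    rw [show 219 * (k : ℝ) * (ε' / (1000 * ((k : ℝ) + 1))) = ε' * (219 * k / (1000 * (k + 1))) by
      field_simp]
    have : 219 * (k : ℝ) / (1000 * (k + 1)) ≤ 1 / 4 := by
      rw [div_le_div_iff₀ (by positivity) (by norm_num)]; nlinarith
    nlinarith
  have hkη1 : (k : ℝ) * η' ≤ 1 := by
    rw [hη'def]
    rw [show (k : ℝ) * (ε' / (1000 * ((k : ℝ) + 1))) = ε' * (k / (1000 * (k + 1))) by field_simp]
    have : (k : ℝ) / (1000 * (k + 1)) ≤ 1 := by
      rw [div_le_one (by positivity)]; nlinarith [(Nat.cast_nonneg k : (0 : ℝ) ≤ k)]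
    nlinarith
  obtain ⟨C₁, hC₁0, hC₁⟩ := Poisson.shell_mass_le
  -- eventual side conditions
  have hA := Poisson.eventually_master_rhs_le μ ε₀ C₁ ε' η' k hμ0 hμ1 hε₀ hε₀1 hC₁0.le hε' hη'
    hkη hk
  filter_upwards [hA, eventually_ge_atTop x₀, eventually_ge_atTop 2, Poisson.eventually_le_log 32,
    Poisson.eventually_le_rpow (1 - ε₀ / 8) 16 (by linarith),
    Poisson.eventually_le_rpow (ε₀ - ε₀ / 8) 4 (by linarith),
    Poisson.eventually_le_rpow θ 3 (by linarith),
    Poisson.eventually_le_rpow (θ - 1 / 2) 2 (by linarith),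
    Poisson.eventually_le_rpow (ε₀ / 8) 4 (by positivity),
    eventually_ge_atTop ⌈2 / η'⌉₊] with x hAx hx₀ hx2 hlog hx16 hx4 hxθ3 hxθ2 hxκ hxη
  have hx1 : 1 ≤ x := by omega
  have hxR : (0 : ℝ) < x := by exact_mod_cast (show 0 < x by omega)
  have hxR1 : (1 : ℝ) ≤ x := by exact_mod_cast hx1
  -- `T`, `L`, `I`
  have hT4 : 4 ≤ ⌊(x : ℝ) ^ (ε₀ / 8)⌋₊ := Nat.le_floor (by exact_mod_cast hxκ)
  have hηx : 2 ≤ η' * x := by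
    have : (⌈2 / η'⌉₊ : ℝ) ≤ x := by exact_mod_cast hxη
    have h2 : 2 / η' ≤ x := (Nat.le_ceil _).trans this
    rwa [div_le_iff₀ hη', mul_comm] at h2
  have hL1 : 1 ≤ ⌊η' * x⌋₊ := Nat.le_floor (by push_cast; linarith)
  have hkL : k * ⌊η' * x⌋₊ ≤ x := by
    have h1 : ((⌊η' * x⌋₊ : ℕ) : ℝ) ≤ η' * x := Nat.floor_le (by positivity)
    have : ((k * ⌊η' * x⌋₊ : ℕ) : ℝ) ≤ x := by
      push_cast
      calc (k : ℝ) * ⌊η' * x⌋₊ ≤ (k : ℝ) * (η' * x) := mul_le_mul_of_nonneg_left h1 (Nat.cast_nonneg _)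
        _ = ((k : ℝ) * η') * x := by ring
        _ ≤ 1 * x := mul_le_mul_of_nonneg_right hkη1 hxR.le
        _ = x := one_mul _
    exact_mod_cast this
  have hg0x := le_floor_rpow_mul_self (θ := θ) hx1 hxθ2
  have hI := reach_of_grid (θ := θ) hx1 (by linarith) (le_trans (by norm_num) hT4)
  -- the tier Weyl bound at `x`, with `ε₀ ≤ ε₀'`
  have hTWx : ∀ P₁ P₁' P₂ P₂' : ℕ, (x : ℝ) ^ θ ≤ 2 * (P₁ : ℝ) → P₁ ≤ P₁' → P₁' ≤ 2 * P₁ →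
      P₁ ≤ P₂ → P₂ ≤ P₂' → P₂' ≤ 2 * P₂ → ((P₁ * P₂ : ℕ) : ℝ) ≤ (x : ℝ) ^ (2 - μ) →
      ∀ h : ℤ, h ≠ 0 → |(h : ℝ)| ≤ ((P₁ * P₂ : ℕ) : ℝ) * (x : ℝ) ^ (ε₀ - 1) →
        ‖∑ Q ∈ (Finset.Ioc P₁ P₁').filter (fun Q : ℕ => Q.Prime ∧ Q % 4 = 1),
          ∑ Q' ∈ (Finset.Ioc P₂ P₂').filter (fun Q' : ℕ => Q'.Prime ∧ Q' % 4 = 1),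
            ((jacobiSym (Q : ℤ) Q' : ℤ) : ℂ) *
              ∑ ν ∈ (Finset.range (Q * Q')).filter (fun ν : ℕ => Q * Q' ∣ ν ^ 2 + 1),
                Complex.exp (2 * Real.pi * Complex.I * ((h : ℤ) : ℂ) * ((ν : ℕ) : ℂ) /
                  ((Q * Q' : ℕ) : ℂ))‖ ≤ (x : ℝ) ^ (1 - ε₀) := by
    intro P₁ P₁' P₂ P₂' h1 h2 h3 h4 h5 h6 h7 h hh0 hhle
    have hb := hT x hx₀ P₁ P₁' P₂ P₂' h1 h2 h3 h4 h5 h6 h7 h hh0 (by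
      refine le_trans (le_of_eq ?_) (hhle.trans (mul_le_mul_of_nonneg_left
        (Real.rpow_le_rpow_of_exponent_le hxR1 (by linarith)) (Nat.cast_nonneg _)))
      simp)
    refine le_trans hb (Real.rpow_le_rpow_of_exponent_le hxR1 (by linarith))
  -- the master inequality and the asymptotic bound
  have hM := Poisson.abs_Dbulk_le_master θ μ ε₀ hθ hθ1 hμ0 hμ1 hε₀ C₁ hC₁ x k ⌊η' * x⌋₊
    ⌊(x : ℝ) ^ (ε₀ / 8)⌋₊ (⌊(x : ℝ) ^ (ε₀ / 8)⌋₊ * (Nat.log 2 (x ^ 2 + 2) + 1)) hx2 hlog hL1 hkL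
    hT4 hx16 hx4 hxθ3 hg0x hI hTWx
  have hD : |Dbulk θ μ x| ≤ ε' * x := by
    unfold Dbulk disc rootCount pairs
    exact hM.trans hAx
  exact hD.trans (mul_le_mul_of_nonneg_right hε'ε hxR.le)


/-- **Def-free form of `stub_poissonReduction`** (the same statement with `TierWeylBound` and
`Dbulk` unfolded; registered as a stub of the crux so that this file lands by name + signature). -/
theorem poissonReduction_defFree :
    ∀ θ μ : ℝ, 1 / 2 < θ → θ < 1 → 0 < μ → μ < 1 → (∃ ε₀ : ℝ, 0 < ε₀ ∧ ∃ x₀ : ℕ, ∀ x : ℕ, x₀ ≤ x → ∀ P₁ P₁' P₂ P₂' : ℕ, (x : ℝ) ^ θ ≤ 2 * (P₁ : ℝ) → P₁ ≤ P₁' → P₁' ≤ 2 * P₁ → P₁ ≤ P₂ → P₂ ≤ P₂' → P₂' ≤ 2 * P₂ → ((P₁ * P₂ : ℕ) : ℝ) ≤ (x : ℝ) ^ (2 - μ) → ∀ h : ℤ, h ≠ 0 → (|h| : ℝ) ≤ ((P₁ * P₂ : ℕ) : ℝ) * (x : ℝ) ^ (ε₀ - 1) → ‖∑ Q ∈ (Finset.Ioc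 P₁ P₁').filter (fun Q : ℕ => Q.Prime ∧ Q % 4 = 1), ∑ Q' ∈ (Finset.Ioc P₂ P₂').filter (fun Q' : ℕ => Q'.Prime ∧ Q' % 4 = 1), (jacobiSym (Q : ℤ) Q' : ℂ) * ∑ ν ∈ (Finset.range (Q * Q')).filter (fun ν : ℕ => Q * Q' ∣ ν ^ 2 + 1), Complex.exp (2 * Real.pi * Complex.I * (h : ℂ) * (ν : ℂ) / ((Q * Q' : ℕ) : ℂ))‖ ≤ (x : ℝ) ^ (1 - ε₀)) → ∀ ε : ℝ, 0 < ε → ∀ᶠ x : ℕ in Filter.atTop, |∑ q ∈ ((Finset.range (x ^ 2 + 2) ×ˢ Finset.range (x ^ 2 + 2)).filter (fun q : ℕ × ℕ => q.1.Prime ∧ q.2.Prime ∧ q.1 % 4 = 1 ∧ q.2 % 4 = 1 ∧ (x : ℝ) ^ θ < (q.1 : ℝ) ∧ q.1 < q.2 ∧ q.1 * q.2 ≤ x ^ 2 + 1)).filter (fun q : ℕ × ℕ => ((q.1 * q.2 : ℕ) : ℝ) ≤ (x : ℝ) ^ (2 - μ)), (jacobiSym (q.1 : ℤ) q.2 : ℝ)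 * (((((Finset.Icc 1 x).filter (fun t : ℕ => q.1 * q.2 ∣ t ^ 2 + 1)).card : ℕ) : ℝ) - 4 * (x : ℝ) / ((q.1 * q.2 : ℕ) : ℝ))| ≤ ε * x :=
  stub_poissonReduction

end Summit.Parity.BatemanHorn.Cruxes.SplitBlockJacobi.CofactorRootDiscrepancy

end
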